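import Summits.HodgeConjecture.HodgeConjecture.Theorems.SixfoldTableXCensusWeilProductRowsGeneral
import Literature.AlgebraicGeometry.HodgeTheory.WeilTypeThreefoldTimesCMThreefoldHodgeLieSU
import Literature.AlgebraicGeometry.HodgeTheory.WeilTypeBlockedHodgeGroupOfLie
import Literature.AlgebraicGeometry.HodgeTheory.CMHodgeGroupCrossedClasses
import Literature.AlgebraicGeometry.VanGeemen1994.WeilTypeEndFieldOfRankTwo
import HarnessLib

/-!
# TABLE X (dimension 6) — ROW 22 `g6.Y3xZ3(CM)` (`A ∼ Y₃ × Z₃`: `Y` a simple threefold of Weil type with `End⁰(Y) = k`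
# imaginary quadratic of multiplicity type `(1,2)`, `Z` a SIMPLE CM threefold, the diagonal `Φ = (φ_Y, φ_Z)` of Weil type `(3,3)`),
# EVERY MEMBER: the census nodes X2 ∕ X1 (+ domain, isogeny class) with L17's displayed general-member hypothesis `hG`
# DISCHARGED — «special members = ∅» for row 22 — and the HC readings ⟸ the DISPLAYED residue binders
# (cell `pub-hodgeav-hg6`, req-37 (A) Q2b; eng-3 g4, brick R22-c; lead g4 GO «R22 a → b → c AS DESIGNED»)

HONEST FRAMING. HC, `HC_AV` (stmt-1333), `HC_CM` (stmt-3052) and H2 are NOT proved and do not occur. X2 ∕ X1 stay `@[conjecture]`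
(OURS); `WeilSixfolds` (stmt-HodgeConjecture-2524), R-W6 and Markman₆ (preprint, unrefereed) appear only as displayed hypotheses
of §2. KERNEL ONLY: theorems over existing declarations; no definition, no `sorry`, no named fact; restates nothing. NO Lie or
Hodge-group hypothesis is displayed.

THE CHAIN (all in the tree): (i) the row-22 Lie theorem at the product `hodgeLieC_threefold_prod_cmThreefold_of_typeOne`
(`WeilTypeThreefoldTimesCMThreefoldHodgeLieSU`, R22-b: the product brick `WeilProductCM.mem_hodgeLieC_of_commute_of_skew_of_trace_of_abelian`
read on `Y × Z`, with `hLie₁` ∕ `hSL₁` discharged by the `(1,2)` unitary core and K1b, `hab₂` ∕ `hY₂` by the CM-torus bricks R22-a)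
⟹ (ii) the BLOCKED Lie → group socket `IsWeilType.mem_hodgeGroupOne_of_mem_unitaryCentralizerGroup_blocked_of_hodgeLieC`
(`WeilTypeBlockedHodgeGroupOfLie`, S3: any block pattern) ⟹ `hG` (§0 `hG_of_threefold_prod_cmThreefold`) ⟹ (iii) L17
`census_weilType_general_prod` at `(dim Y, dim C) = (3, 3)` (§1) and L16's no-domain HC readings (§2). The conversion «commutes
with Milne's generator `φ_E^*`» ⟹ «commutes with EVERY pull-back `g^*` (`g ∈ End(Y × Z)`)» — in particular with the projector
`e₁^* = (fst ≫ prodLift (𝟙 Y) 0)^*` and with `(snd ≫ g ≫ prodLift 0 (𝟙 Z))^*` for `g ∈ End Z` — is PROVED from the socket's own data: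
`End_Hdg(H¹(Y × Z)) = ℚ[φ_E^*]` (`exists_eq_sum_smul_pow_bettiMapHom_fin`: `finrank_ℚ End⁰ = 2|ι|` and `2|ι|` distinct eigenvalues
with non-zero eigenspaces), so every `g^*` is a rational polynomial in `φ_E^*`, acting by a scalar on each eigenspace of `φ_E^*_ℂ`
(`baseChange_sum_smul_pow_apply_fin`), and an operator commuting with `φ_E^*_ℂ` preserves those eigenspaces (they span, `htop`).
`Y` simple and NOT of CM type are DERIVED (`VanGeemen1994.isSimple_of_finrank_endAlgebra_eq_two`,
`VanGeemen1994.not_isOfCMType_of_finrank_endAlgebra_eq_two`), not displayed.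

MEMBER DATA OF RECORD (row 22, every member, stated AT THE PRODUCT `Y × Z`; every member `A' ∼ Y × Z` is covered by the
`_of_isIsogenous` forms): `Y` of dimension `3` with `finrank_ℚ End⁰(Y) = 2`, `φ_Y ≫ φ_Y = −d`, multiplicity `1` at `i√d` or at `−i√d`;
`Z` SIMPLE of dimension `3` carrying a CM-type realisation `(K, Φcm, ι_Z, θ)` (L17's row-22 `C`-factor is a simple CM threefold; a
simple CM abelian variety is isogenous to a CM-typed one, `exists_isCMTyped_isIsogenous_of_isSimple`, and the verdict is read on the
isogeny class — so the member set is L17's row-22 set, the realisation being a presentation of the `C`-factor, not a restriction) and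
`φ_Z ≫ φ_Z = −d`; the diagonal `Φ` (`Φ ≫ fst = fst ≫ φ_Y`, `Φ ≫ snd = snd ≫ φ_Z`) of Weil type `(3, d)`; Milne's single-generator data
for `C(Y × Z) ⊗ ℂ` (`φ_E`, `hC`, `hdiag`, `J'`, `hJ'`, `hJQ`) and the socket's block data on the SAME `φ_E` (`finrank_ℚ End⁰(Y × Z) = 2|ι|`
— i.e. `Hom(Y, Z) = 0`, `End⁰ = k × K` —, colours `μ` with non-zero blocks spanning `H¹`, `W_{μ k} ⊆ W_Φ(i√d)`, `W_{μ̄ k} ⊆ W_Φ(−i√d)`),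
a rational class `h` with a Kähler multiple and `hφQ`. All declarations in L17's namespace `TableX.WeilERows`; typed ≠ proved.

## References
* [MoonenZarhin1999LowDim] B. Moonen, Yu. Zarhin, Math. Ann. 315 (1999), Thm. 0.2, §2 (2.3), (2.4), §5 (5.1), (5.11).
* [Milne1999LefschetzClasses] J. S. Milne, Duke Math. J. 96 (1999), §2 pp. 645–650, Thm. 3.2 and Cor. 4.5.
* [vanGeemen1994HodgeAV] B. van Geemen, LNM 1594 (1994), Lemma 3.7, Thm. 4.9 and Thm. 6.12.
* [Deligne1982HodgeCycles] P. Deligne, LNM 900 (1982), I §3 Prop. 3.4, 3.6 and Ex. 3.7.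
-/

set_option linter.dupNamespace false

noncomputable section

open scoped TensorProduct
open CategoryTheory CategoryTheory.Limits NumberField
open Literature.AlgebraicGeometry Literature.AlgebraicGeometry.Motives
open Literature.AlgebraicGeometry.Motives.AbelianVariety
open Literature.AlgebraicGeometry.Motives.HodgeStructure
open Literature.AlgebraicGeometry.HodgeTheory
open Literature.AlgebraicGeometry.Milne1999
open Literature.AlgebraicGeometry.ComplexMultiplication (bettiRep bettiRep_of IsCMTypeRealisation)
open Literature.AlgebraicGeometry.Deligne1982 (isOfHodgeType_one_one_of_isKaehlerClass_smul)
open Literature.AlgebraicGeometry.VanGeemen1994 (pullbackOne hodgeGroupOne detOnEigenspace hodgeClassSpan)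
open Literature.AlgebraicTopology.SingularHomology
open Literature.Barriers.HodgeConjecture
open Literature.Geometry.Kaehler (HasHardLefschetzProperty)
open Summit.HodgeConjecture.HodgeConjecture.Ring2.ClassTargets
open Summit.HodgeConjecture.HodgeConjecture.Ring2.Motiv (ProdCMCell)
open Summit.HodgeConjecture.HodgeConjecture.Ring2.Atlas (IsQuarticFieldTypeIVFourfold)

namespace Summit.HodgeConjecture.HodgeConjecture.TableX.WeilERows

variable {Y Z : AbelianVariety ℂ} {h : complexBetti (Y.prod Z).X 2}

/-- The two elements of `Fin 2`. [folklore] -/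
private theorem fin2_eq_zero_or_one (r : Fin 2) : r = 0 ∨ r = 1 := by
  rcases r with ⟨_ | _ | n, hr⟩
  · exact Or.inl rfl
  · exact Or.inr rfl
  · omega
/-! ## §0 The group hypothesis `hG` of L17 is a theorem at `Y₃ × Z₃` -/

/-- **`hG` FOR ROW 22 AT THE PRODUCT `Y₃ × Z₃`** (see the module docstring): R22-b's Lie theorem ∘ the blocked socket S3; `h` a
rational class with a Kähler multiple for which `Φ^*` is a `d`-similitude. The socket's «commutes with `φ_E^*_ℂ`» is converted
into «commutes with every pull-back `g^*_ℂ`» through `End_Hdg(H¹) = ℚ[φ_E^*]`. Nothing displayed beyond member data. HC NOT proved.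
[cite: MoonenZarhin1999LowDim, §2 (2.3), (2.4) and §5 (5.1), (5.11)] [cite: Deligne1982HodgeCycles, I §3 Prop. 3.4 and 3.6]
[cite: Ribet1983, Thm. 0] -/
theorem hG_of_threefold_prod_cmThreefold
    (hY3 : Y.dim = 3) (φY : Y ⟶ Y) {d : ℕ} (hd : 0 < d) (hφY : φY ≫ φY = -(d • 𝟙 Y))
    (hE2 : Module.finrank ℚ Y.endAlgebra = 2)
    (h1 : eigenMultiplicity Y φY (Complex.I * (Real.sqrt d : ℂ)) = 1 ∨
      eigenMultiplicity Y φY (-(Complex.I * (Real.sqrt d : ℂ))) = 1)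
    {K : Type} [Field K] [NumberField K] [IsCMField K] {Φcm : CMType K} {ιZ : 𝓞 K →+* End Z}
    {θ : K →+* Module.End ℂ (complexBetti Z.X 1)} (hcm : IsCMTypeRealisation Φcm Z ιZ θ) (hZs : Z.IsSimple) (hZ3 : Z.dim = 3)
    (φZ : Z ⟶ Z) (hφZ : φZ ≫ φZ = -(d • 𝟙 Z))
    (Φ : Y.prod Z ⟶ Y.prod Z) (hΦ₁ : Φ ≫ fst Y Z = fst Y Z ≫ φY) (hΦ₂ : Φ ≫ snd Y Z = snd Y Z ≫ φZ)
    (hW : IsWeilType (Y.prod Z) Φ 3 d)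
    (φE : Y.prod Z ⟶ Y.prod Z) {ι : Type} [Fintype ι] [DecidableEq ι]
    (hEcard : Module.finrank ℚ (Y.prod Z).endAlgebra = 2 * Fintype.card ι)
    (μ : ι → ℂ) (hinj : Function.Injective μ) (hdist : ∀ k k', μ k' ≠ starRingEnd ℂ (μ k))
    (hWne : ∀ kt : ι × Fin 2, Module.End.eigenspace (((bettiCohomology.map φE.hom.hom.hom 1).hom).baseChange ℂ)
      (if kt.2 = 0 then μ kt.1 else starRingEnd ℂ (μ kt.1)) ≠ ⊥)
    (htop : (⨆ kt : ι × Fin 2, Module.End.eigenspace (((bettiCohomology.map φE.hom.hom.hom 1).hom).baseChange ℂ)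
      (if kt.2 = 0 then μ kt.1 else starRingEnd ℂ (μ kt.1))) = ⊤)
    (hKE : ∀ k, Module.End.eigenspace (((bettiCohomology.map φE.hom.hom.hom 1).hom).baseChange ℂ) (μ k) ≤
      Module.End.eigenspace (((bettiCohomology.map Φ.hom.hom.hom 1).hom).baseChange ℂ) (Complex.I * (Real.sqrt d : ℂ)))
    (hKE' : ∀ k, Module.End.eigenspace (((bettiCohomology.map φE.hom.hom.hom 1).hom).baseChange ℂ) (starRingEnd ℂ (μ k)) ≤
      Module.End.eigenspace (((bettiCohomology.map Φ.hom.hom.hom 1).hom).baseChange ℂ) (-(Complex.I * (Real.sqrt d : ℂ))))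
    (hQ : IsRationalClass h) (hK : ∃ s : ℝ, 0 < s ∧ IsKaehlerClass (Y.prod Z).dim (Y.prod Z).X ((s : ℂ) • h))
    (hφQ : ∀ x y, polarizationPairingOne (Y.prod Z).X h ((Y.prod Z).dim - 1) (pullbackOne (Y.prod Z) Φ x)
        (pullbackOne (Y.prod Z) Φ y) = (d : ℂ) • polarizationPairingOne (Y.prod Z).X h ((Y.prod Z).dim - 1) x y) :
    ∀ (u : complexBetti (Y.prod Z).X 1 ≃ₗ[ℂ] complexBetti (Y.prod Z).X 1) (hu : u ∈ unitaryCentralizerGroup (Y.prod Z) h),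
      detOnEigenspace u (pullbackOne (Y.prod Z) Φ) (fun x ↦ (mem_centralizerGroup_iff.1 hu.1) Φ x)
        (Complex.I * (Real.sqrt d : ℂ)) = 1 → u ∈ hodgeGroupOne (Y.prod Z).dim (Y.prod Z).X := by
  haveI : HodgeTensorFacts.{0, 0} := hodgeTensorFacts_holds
  obtain ⟨ψ⟩ := BettiUniverse.hodge_isPolarizable exists_isReal_hodgeModel_holds
    (AbelianVariety.isSmoothProjective_holds (A := Y.prod Z)) 1
  have hX : IsSmoothProjective (Y.prod Z).dim (Y.prod Z).X := AbelianVariety.isSmoothProjective_holds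
  -- `h` is a rational `(1,1)`-class; `Q_h` is non-degenerate on `H¹` (hard Lefschetz)
  obtain ⟨s, hs, hsK⟩ := hK
  have h11 : IsOfHodgeType (Y.prod Z).dim (Y.prod Z).X (2 * 1) 1 1 h :=
    isOfHodgeType_one_one_of_isKaehlerClass_smul ⟨s, hs.ne', hsK⟩
  have hh : h ∈ hodgeClassSpan (Y.prod Z).dim (Y.prod Z).X 1 := Submodule.subset_span ⟨hQ, h11⟩
  have hHL : HasHardLefschetzProperty h (Y.prod Z).dim := by
    have h1' := HasHardLefschetzProperty.smul
      (hsK.hasHardLefschetzProperty hX fun _ ↦ Motives.hasHardLefschetzProperty_kaehlerClass_holds)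
      (inv_ne_zero (Complex.ofReal_ne_zero.2 hs.ne'))
    rwa [smul_smul, inv_mul_cancel₀ (Complex.ofReal_ne_zero.2 hs.ne'), one_smul] at h1'
  have hnd : ∀ x : complexBetti (Y.prod Z).X 1,
      (∀ y, polarizationPairingOne (Y.prod Z).X h ((Y.prod Z).dim - 1) x y = 0) → x = 0 :=
    fun x hx => eq_zero_of_forall_polarizationPairingOne_eq_zero_of_hasHardLefschetzProperty
      (by rw [hW.dim_eq]; norm_num) hHL hx
  -- `End_Hdg(H¹(Y × Z)) = ℚ[φ_E^*]`: every pull-back is a rational polynomial in `φ_E^*`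
  have hHD : exists_isReal_hodgeModel := exists_isReal_hodgeModel_holds
  have hI : hodgePQ_independent_of_hodgeModel := hodgePQ_independent_of_hodgeModel_holds
  have hev : Function.Injective (fun kt : ι × Fin 2 => if kt.2 = 0 then μ kt.1 else starRingEnd ℂ (μ kt.1)) := by
    rintro ⟨k, t⟩ ⟨k', t'⟩ h
    rcases fin2_eq_zero_or_one t with rfl | rfl <;> rcases fin2_eq_zero_or_one t' with rfl | rfl
    · simp only [if_true] at h; rw [hinj h]
    · simp only [if_true, one_ne_zero, if_false] at h; exact absurd h (hdist k' k)
    · simp only [one_ne_zero, if_false, if_true] at h; exact absurd h.symm (hdist k k')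
    · simp only [one_ne_zero, if_false] at h; rw [hinj ((starRingEnd ℂ).injective h)]
  have hcard : Fintype.card (ι × Fin 2) = 2 * Fintype.card ι := by rw [Fintype.card_prod, Fintype.card_fin, mul_comm]
  set eqv : ι × Fin 2 ≃ Fin (2 * Fintype.card ι) := Fintype.equivFinOfCardEq hcard with heqv
  have hEφ := exists_eq_sum_smul_pow_bettiMapHom_fin hHD hI φE hEcard (fun j => if (eqv.symm j).2 = 0 then μ (eqv.symm j).1
      else starRingEnd ℂ (μ (eqv.symm j).1)) (hev.comp eqv.symm.injective) (fun j => hWne (eqv.symm j))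
  -- the Lie statement in the socket's shape
  have hLie := hodgeLieC_threefold_prod_cmThreefold_of_typeOne hY3 φY hd hφY hE2 h1 hcm hZs hZ3 φZ hφZ Φ hΦ₁ hΦ₂ hW ψ
  have hSU : ∀ (Yop : Module.End ℂ (ℂ ⊗[ℚ] bettiCohomology (Y.prod Z).X 1))
      (hYφ : Yop * ((bettiCohomology.map Φ.hom.hom.hom 1).hom).baseChange ℂ =
        ((bettiCohomology.map Φ.hom.hom.hom 1).hom).baseChange ℂ * Yop),
      Yop * ((bettiCohomology.map φE.hom.hom.hom 1).hom).baseChange ℂ =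
        ((bettiCohomology.map φE.hom.hom.hom 1).hom).baseChange ℂ * Yop →
      (∀ x y, ψ.form.baseChange ℂ (Yop x) y + ψ.form.baseChange ℂ x (Yop y) = 0) →
      LinearMap.trace ℂ _ (Yop.restrict fun x (hx : x ∈ Module.End.eigenspace
          (((bettiCohomology.map Φ.hom.hom.hom 1).hom).baseChange ℂ) (Complex.I * (Real.sqrt d : ℂ))) =>
        UnitaryTheta.apply_mem_eigenspace_of_commute hYφ hx) = 0 →
      Yop ∈ (BettiUniverse.hodge exists_isReal_hodgeModel_holds
        (AbelianVariety.isSmoothProjective_holds (A := Y.prod Z)) 1).hodgeLieC := by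
    intro Yop hYφ hYφE hYskew hYtr
    -- `Yop` commutes with EVERY pull-back `g^*_ℂ`: `g^* = Σ q_k (φ_E^*)^k` acts by a scalar on every eigenspace of `φ_E^*_ℂ`
    have hYg : ∀ g : Y.prod Z ⟶ Y.prod Z, Yop * ((bettiCohomology.map g.hom.hom.hom 1).hom).baseChange ℂ =
        ((bettiCohomology.map g.hom.hom.hom 1).hom).baseChange ℂ * Yop := by
      intro g
      have hgE : (bettiCohomology.map g.hom.hom.hom 1).hom ∈
          (BettiUniverse.hodge hHD (AbelianVariety.isSmoothProjective_holds (A := Y.prod Z)) 1).endAlg := by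
        have h' := unop_bettiRep_mem_endAlg hHD hI (AbelianVariety.endAlgebra.of (Y.prod Z) g)
        rwa [bettiRep_of, MulOpposite.unop_op] at h'
      obtain ⟨q, hq⟩ := hEφ _ hgE
      have hB : ∀ {c : ℂ} {w : ℂ ⊗[ℚ] bettiCohomology (Y.prod Z).X 1},
          w ∈ Module.End.eigenspace (((bettiCohomology.map φE.hom.hom.hom 1).hom).baseChange ℂ) c →
          ((bettiCohomology.map g.hom.hom.hom 1).hom).baseChange ℂ w = (∑ k, (q k : ℂ) * c ^ (k : ℕ)) • w := by
        intro c w hw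
        have h' := baseChange_sum_smul_pow_apply_fin _ q hw
        rwa [← hq] at h'
      refine LinearMap.ext fun v => ?_
      have hv : v ∈ ⨆ kt : ι × Fin 2, Module.End.eigenspace (((bettiCohomology.map φE.hom.hom.hom 1).hom).baseChange ℂ)
          (if kt.2 = 0 then μ kt.1 else starRingEnd ℂ (μ kt.1)) := by rw [htop]; exact Submodule.mem_top
      refine Submodule.iSup_induction _
        (motive := fun v => (Yop * ((bettiCohomology.map g.hom.hom.hom 1).hom).baseChange ℂ) v =
          (((bettiCohomology.map g.hom.hom.hom 1).hom).baseChange ℂ * Yop) v) hv (fun kt w hw => ?_)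
        (by simp only [map_zero]) (fun x y hx hy => by simp only [map_add, hx, hy])
      rw [Module.End.mul_apply, Module.End.mul_apply, hB hw, hB (UnitaryTheta.apply_mem_eigenspace_of_commute hYφE hw),
        map_smul]
    exact hLie Yop (hYg _) hYφ (fun g => hYg _) hYskew hYtr
  exact fun u hu hdet ↦ hW.mem_hodgeGroupOne_of_mem_unitaryCentralizerGroup_blocked_of_hodgeLieC φE hEcard μ hinj hdist
    hWne htop hKE hKE' ψ hSU hh hnd hφQ u hu hdet

/-! ## §1 Row 22, every member: the census on the isogeny class of the product, `hG` discharged -/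

/-- **TABLE X ROW 22 `g6.Y3xZ3(CM)` — EVERY MEMBER `A' ∼ Y₃ × Z₃`, KERNEL VERDICT WITH DOMAIN MEMBERSHIP ON THE WHOLE ISOGENY
CLASS OF THE PRODUCT, NO Hodge-group hypothesis displayed**: L17's `census_weilType_general_prod_of_isIsogenous` at
`(dim Y, dim C) = (3, 3)` with `hG` DISCHARGED by §0 (`A' = Y × Z` via `IsIsogenous.refl`); `Y` simple and non-CM DERIVED from
`End⁰(Y) = k`. Conclusion `(dim = 6 ∧ ¬ 𝒞) ∧` X2 `∧` X1 at `A'`. «Special members = ∅» for row 22. HC NOT proved. [cite: MoonenZarhin1999LowDim, Thm. 0.2 and §5 (5.1), (5.11)]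
[cite: Milne1999LefschetzClasses, Thm. 3.2 and Cor. 4.5] [cite: vanGeemen1994HodgeAV, Lemma 3.7 and Thm. 6.12] -/
theorem census_row22_of_isIsogenous_threefold_prod_cmThreefold {A' : AbelianVariety ℂ}
    (hY3 : Y.dim = 3) (φY : Y ⟶ Y) {d : ℕ} (hd : 0 < d) (hφY : φY ≫ φY = -(d • 𝟙 Y))
    (hE2 : Module.finrank ℚ Y.endAlgebra = 2)
    (h1 : eigenMultiplicity Y φY (Complex.I * (Real.sqrt d : ℂ)) = 1 ∨
      eigenMultiplicity Y φY (-(Complex.I * (Real.sqrt d : ℂ))) = 1)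
    {K : Type} [Field K] [NumberField K] [IsCMField K] {Φcm : CMType K} {ιZ : 𝓞 K →+* End Z}
    {θ : K →+* Module.End ℂ (complexBetti Z.X 1)} (hcm : IsCMTypeRealisation Φcm Z ιZ θ) (hZs : Z.IsSimple) (hZ3 : Z.dim = 3)
    (φZ : Z ⟶ Z) (hφZ : φZ ≫ φZ = -(d • 𝟙 Z))
    (Φ : Y.prod Z ⟶ Y.prod Z) (hΦ₁ : Φ ≫ fst Y Z = fst Y Z ≫ φY) (hΦ₂ : Φ ≫ snd Y Z = snd Y Z ≫ φZ)
    (hW : IsWeilType (Y.prod Z) Φ 3 d)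
    (φE : Y.prod Z ⟶ Y.prod Z) {ι : Type} [Fintype ι] [DecidableEq ι]
    (hEcard : Module.finrank ℚ (Y.prod Z).endAlgebra = 2 * Fintype.card ι)
    (μ : ι → ℂ) (hinj : Function.Injective μ) (hdist : ∀ k k', μ k' ≠ starRingEnd ℂ (μ k))
    (hWne : ∀ kt : ι × Fin 2, Module.End.eigenspace (((bettiCohomology.map φE.hom.hom.hom 1).hom).baseChange ℂ)
      (if kt.2 = 0 then μ kt.1 else starRingEnd ℂ (μ kt.1)) ≠ ⊥)
    (htop : (⨆ kt : ι × Fin 2, Module.End.eigenspace (((bettiCohomology.map φE.hom.hom.hom 1).hom).baseChange ℂ)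
      (if kt.2 = 0 then μ kt.1 else starRingEnd ℂ (μ kt.1))) = ⊤)
    (hKE : ∀ k, Module.End.eigenspace (((bettiCohomology.map φE.hom.hom.hom 1).hom).baseChange ℂ) (μ k) ≤
      Module.End.eigenspace (((bettiCohomology.map Φ.hom.hom.hom 1).hom).baseChange ℂ) (Complex.I * (Real.sqrt d : ℂ)))
    (hKE' : ∀ k, Module.End.eigenspace (((bettiCohomology.map φE.hom.hom.hom 1).hom).baseChange ℂ) (starRingEnd ℂ (μ k)) ≤
      Module.End.eigenspace (((bettiCohomology.map Φ.hom.hom.hom 1).hom).baseChange ℂ) (-(Complex.I * (Real.sqrt d : ℂ))))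
    (hC : centralizerAlgebra (Y.prod Z) = Subalgebra.centralizer ℂ {pullbackOne (Y.prod Z) φE})
    (hdiag : ⨆ m : ℂ, Module.End.eigenspace (pullbackOne (Y.prod Z) φE) m = ⊤)
    (hQ : IsRationalClass h) (hK : ∃ s : ℝ, 0 < s ∧ IsKaehlerClass (Y.prod Z).dim (Y.prod Z).X ((s : ℂ) • h))
    (J' : Module.End ℂ (complexBetti (Y.prod Z).X 1))
    (hJ' : J' ∈ Subalgebra.centralizer ℂ (centralizerAlgebra (Y.prod Z) : Set (Module.End ℂ (complexBetti (Y.prod Z).X 1))))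
    (hJQ : ∀ x y : complexBetti (Y.prod Z).X 1,
      polarizationPairingOne (Y.prod Z).X h ((Y.prod Z).dim - 1) (pullbackOne (Y.prod Z) φE x) y =
        polarizationPairingOne (Y.prod Z).X h ((Y.prod Z).dim - 1) x (J' y))
    (hφQ : ∀ x y, polarizationPairingOne (Y.prod Z).X h ((Y.prod Z).dim - 1) (pullbackOne (Y.prod Z) Φ x)
        (pullbackOne (Y.prod Z) Φ y) = (d : ℂ) • polarizationPairingOne (Y.prod Z).X h ((Y.prod Z).dim - 1) x y)
    (hA'A : IsIsogenous A' (Y.prod Z)) :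
    (A'.dim = 6 ∧ ¬ (IsOfCMType A' ∨ ProdCMCell IsQuarticFieldTypeIVFourfold (fun W ↦ W.dim = 2) A')) ∧
    (∀ c : complexBetti A'.X (2 * 2), IsRationalClass c → IsOfHodgeType A'.dim A'.X (2 * 2) 2 2 c →
      c ∈ divisorClassesSpan A'.X A'.dim 2 ⊔ Submodule.span ℂ {w' : complexBetti A'.X (2 * 2) |
        ∃ (C : AbelianVariety ℂ) (g : A'.X ⟶ C.X) (w : complexBetti C.X (2 * 2)), C.dim < A'.dim ∧
          IsRationalClass w ∧ IsOfHodgeType C.dim C.X (2 * 2) 2 2 w ∧ w' = complexBetti.map g (2 * 2) w}) ∧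
    (∀ c : complexBetti A'.X (2 * 3), IsRationalClass c → IsOfHodgeType A'.dim A'.X (2 * 3) 3 3 c →
      c ∈ divisorClassesSpan A'.X A'.dim 3 ⊔ Submodule.span ℂ {w' : complexBetti A'.X (2 * 3) |
          ∃ (a : complexBetti A'.X (2 * 2)) (b : complexBetti A'.X (2 * 1)),
            IsRationalClass a ∧ IsOfHodgeType A'.dim A'.X (2 * 2) 2 2 a ∧ IsRationalClass b ∧
            IsOfHodgeType A'.dim A'.X (2 * 1) 1 1 b ∧ w' = cupProduct (two_mul_add_two_mul 2 1) a b} ⊔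
        Submodule.span ℂ {w' : complexBetti A'.X (2 * 3) |
          ∃ (C : AbelianVariety ℂ) (g : A'.X ⟶ C.X) (w : complexBetti C.X (2 * 3)), C.dim < A'.dim ∧
            IsRationalClass w ∧ IsOfHodgeType C.dim C.X (2 * 3) 3 3 w ∧ w' = complexBetti.map g (2 * 3) w} ⊔
        Submodule.span ℂ {w' : complexBetti A'.X (2 * 3) |
          ∃ (B' : AbelianVariety ℂ) (g : A'.X ⟶ B'.X) (d : ℕ) (ψ : B' ⟶ B') (w : complexBetti B'.X (2 * 3)),
            B'.dim = 6 ∧ 0 < d ∧ ψ ≫ ψ = -(d • 𝟙 B') ∧ IsRationalClass w ∧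
            IsOfHodgeType B'.dim B'.X (2 * 3) 3 3 w ∧ w ∈ weilClassesOf B' ψ 3 d ∧
            w' = complexBetti.map g (2 * 3) w}) := by
  haveI : HodgeTensorFacts.{0, 0} := hodgeTensorFacts_holds
  have h0Y : 0 < Y.dim := by omega
  have hY : Y.dim ≠ 4 ∨ Module.finrank ℚ Y.endAlgebra ≠ 4 := Or.inl (by omega)
  have hYs : Y.IsSimple := VanGeemen1994.isSimple_of_finrank_endAlgebra_eq_two h0Y hd hφY hE2
  have hYcm : ¬ IsOfCMType Y := VanGeemen1994.not_isOfCMType_of_finrank_endAlgebra_eq_two (by omega) hd hφY hE2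
  have h0C : 0 < Z.dim := by omega
  have hC4 : Z.dim < 4 := by omega
  exact census_weilType_general_prod_of_isIsogenous (Y.prod Z) Φ d hYs hYcm h0Y hY hZs h0C hC4 (IsIsogenous.refl _) hW φE hC
    hdiag hQ hK J' hJ' hJQ hφQ (hG_of_threefold_prod_cmThreefold hY3 φY hd hφY hE2 h1 hcm hZs hZ3 φZ hφZ Φ hΦ₁ hΦ₂ hW φE hEcard
      μ hinj hdist hWne htop hKE hKE' hQ hK hφQ) hA'A

/-! ## §2 HC at every such member ⟸ the DISPLAYED residue binders (`WeilSixfolds`, or {Markman₆, R-W6}) -/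

/-- **HC on the isogeny class of every row-22 product `Y₃ × Z₃` ⟸ the ladder item `WeilSixfolds` (stmt-HodgeConjecture-2524,
DISPLAYED, not asserted)** — L16's `hodgeConjectureFor_weilType_generalE_of_weilSixfolds` (no domain hypothesis) with `hG`
discharged by §0, transported by `HodgeConjectureFor.of_isIsogenous`. HC NOT proved unconditionally.
[cite: vanGeemen1994HodgeAV, 2.4 and Thm. 6.12] [cite: Milne1999LefschetzClasses, Cor. 4.5]
[cite: MoonenZarhin1999LowDim, Thm. 0.2, (2.3) and (5.11)] -/
theorem hodgeConjectureFor_of_isIsogenous_row22_of_weilSixfolds {A' : AbelianVariety ℂ}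
    (hW₆ : Theses.SevenfoldWeilCensus.WeilSixfolds)
    (hY3 : Y.dim = 3) (φY : Y ⟶ Y) {d : ℕ} (hd : 0 < d) (hφY : φY ≫ φY = -(d • 𝟙 Y))
    (hE2 : Module.finrank ℚ Y.endAlgebra = 2)
    (h1 : eigenMultiplicity Y φY (Complex.I * (Real.sqrt d : ℂ)) = 1 ∨
      eigenMultiplicity Y φY (-(Complex.I * (Real.sqrt d : ℂ))) = 1)
    {K : Type} [Field K] [NumberField K] [IsCMField K] {Φcm : CMType K} {ιZ : 𝓞 K →+* End Z}
    {θ : K →+* Module.End ℂ (complexBetti Z.X 1)} (hcm : IsCMTypeRealisation Φcm Z ιZ θ) (hZs : Z.IsSimple) (hZ3 : Z.dim = 3)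
    (φZ : Z ⟶ Z) (hφZ : φZ ≫ φZ = -(d • 𝟙 Z))
    (Φ : Y.prod Z ⟶ Y.prod Z) (hΦ₁ : Φ ≫ fst Y Z = fst Y Z ≫ φY) (hΦ₂ : Φ ≫ snd Y Z = snd Y Z ≫ φZ)
    (hW : IsWeilType (Y.prod Z) Φ 3 d)
    (φE : Y.prod Z ⟶ Y.prod Z) {ι : Type} [Fintype ι] [DecidableEq ι]
    (hEcard : Module.finrank ℚ (Y.prod Z).endAlgebra = 2 * Fintype.card ι)
    (μ : ι → ℂ) (hinj : Function.Injective μ) (hdist : ∀ k k', μ k' ≠ starRingEnd ℂ (μ k))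
    (hWne : ∀ kt : ι × Fin 2, Module.End.eigenspace (((bettiCohomology.map φE.hom.hom.hom 1).hom).baseChange ℂ)
      (if kt.2 = 0 then μ kt.1 else starRingEnd ℂ (μ kt.1)) ≠ ⊥)
    (htop : (⨆ kt : ι × Fin 2, Module.End.eigenspace (((bettiCohomology.map φE.hom.hom.hom 1).hom).baseChange ℂ)
      (if kt.2 = 0 then μ kt.1 else starRingEnd ℂ (μ kt.1))) = ⊤)
    (hKE : ∀ k, Module.End.eigenspace (((bettiCohomology.map φE.hom.hom.hom 1).hom).baseChange ℂ) (μ k) ≤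
      Module.End.eigenspace (((bettiCohomology.map Φ.hom.hom.hom 1).hom).baseChange ℂ) (Complex.I * (Real.sqrt d : ℂ)))
    (hKE' : ∀ k, Module.End.eigenspace (((bettiCohomology.map φE.hom.hom.hom 1).hom).baseChange ℂ) (starRingEnd ℂ (μ k)) ≤
      Module.End.eigenspace (((bettiCohomology.map Φ.hom.hom.hom 1).hom).baseChange ℂ) (-(Complex.I * (Real.sqrt d : ℂ))))
    (hC : centralizerAlgebra (Y.prod Z) = Subalgebra.centralizer ℂ {pullbackOne (Y.prod Z) φE})
    (hdiag : ⨆ m : ℂ, Module.End.eigenspace (pullbackOne (Y.prod Z) φE) m = ⊤)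
    (hQ : IsRationalClass h) (hK : ∃ s : ℝ, 0 < s ∧ IsKaehlerClass (Y.prod Z).dim (Y.prod Z).X ((s : ℂ) • h))
    (J' : Module.End ℂ (complexBetti (Y.prod Z).X 1))
    (hJ' : J' ∈ Subalgebra.centralizer ℂ (centralizerAlgebra (Y.prod Z) : Set (Module.End ℂ (complexBetti (Y.prod Z).X 1))))
    (hJQ : ∀ x y : complexBetti (Y.prod Z).X 1,
      polarizationPairingOne (Y.prod Z).X h ((Y.prod Z).dim - 1) (pullbackOne (Y.prod Z) φE x) y =
        polarizationPairingOne (Y.prod Z).X h ((Y.prod Z).dim - 1) x (J' y))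
    (hφQ : ∀ x y, polarizationPairingOne (Y.prod Z).X h ((Y.prod Z).dim - 1) (pullbackOne (Y.prod Z) Φ x)
        (pullbackOne (Y.prod Z) Φ y) = (d : ℂ) • polarizationPairingOne (Y.prod Z).X h ((Y.prod Z).dim - 1) x y)
    (hA'A : IsIsogenous A' (Y.prod Z)) : HodgeConjectureFor A'.dim A'.X := by
  haveI : HodgeTensorFacts.{0, 0} := hodgeTensorFacts_holds
  exact HodgeConjectureFor.of_isIsogenous hA'A
    (hodgeConjectureFor_weilType_generalE_of_weilSixfolds (Y.prod Z) Φ d hW₆ hW φE hC hdiag hQ hK J' hJ' hJQ hφQ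
      (hG_of_threefold_prod_cmThreefold hY3 φY hd hφY hE2 h1 hcm hZs hZ3 φZ hφZ Φ hΦ₁ hΦ₂ hW φE hEcard μ hinj hdist hWne htop
        hKE hKE' hQ hK hφQ))

/-- **HC on the isogeny class of every row-22 product `Y₃ × Z₃` ⟸ {Markman₆ (preprint, UNREFEREED), R-W6 (OPEN)}, both
DISPLAYED, not asserted** — L16's `hodgeConjectureFor_weilType_generalE_of_markman₆_nonsplit` with `hG` discharged by §0,
transported by `HodgeConjectureFor.of_isIsogenous`. HC NOT proved unconditionally. [cite: Markman2025SecantWeil, Thm. 1.5.1 (preprint, unrefereed)]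
[cite: vanGeemen1994HodgeAV, Thm. 6.12] [cite: MoonenZarhin1999LowDim, Thm. 0.2 and (5.11)] -/
theorem hodgeConjectureFor_of_isIsogenous_row22_of_markman₆_nonsplit {A' : AbelianVariety ℂ}
    (hMark₆ : Markman2025_weilClasses_algebraic_hyperbolicSixfold) (hRW6 : WeilTypeLadder.NonsplitSixfolds)
    (hY3 : Y.dim = 3) (φY : Y ⟶ Y) {d : ℕ} (hd : 0 < d) (hφY : φY ≫ φY = -(d • 𝟙 Y))
    (hE2 : Module.finrank ℚ Y.endAlgebra = 2)
    (h1 : eigenMultiplicity Y φY (Complex.I * (Real.sqrt d : ℂ)) = 1 ∨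
      eigenMultiplicity Y φY (-(Complex.I * (Real.sqrt d : ℂ))) = 1)
    {K : Type} [Field K] [NumberField K] [IsCMField K] {Φcm : CMType K} {ιZ : 𝓞 K →+* End Z}
    {θ : K →+* Module.End ℂ (complexBetti Z.X 1)} (hcm : IsCMTypeRealisation Φcm Z ιZ θ) (hZs : Z.IsSimple) (hZ3 : Z.dim = 3)
    (φZ : Z ⟶ Z) (hφZ : φZ ≫ φZ = -(d • 𝟙 Z))
    (Φ : Y.prod Z ⟶ Y.prod Z) (hΦ₁ : Φ ≫ fst Y Z = fst Y Z ≫ φY) (hΦ₂ : Φ ≫ snd Y Z = snd Y Z ≫ φZ)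
    (hW : IsWeilType (Y.prod Z) Φ 3 d)
    (φE : Y.prod Z ⟶ Y.prod Z) {ι : Type} [Fintype ι] [DecidableEq ι]
    (hEcard : Module.finrank ℚ (Y.prod Z).endAlgebra = 2 * Fintype.card ι)
    (μ : ι → ℂ) (hinj : Function.Injective μ) (hdist : ∀ k k', μ k' ≠ starRingEnd ℂ (μ k))
    (hWne : ∀ kt : ι × Fin 2, Module.End.eigenspace (((bettiCohomology.map φE.hom.hom.hom 1).hom).baseChange ℂ)
      (if kt.2 = 0 then μ kt.1 else starRingEnd ℂ (μ kt.1)) ≠ ⊥)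
    (htop : (⨆ kt : ι × Fin 2, Module.End.eigenspace (((bettiCohomology.map φE.hom.hom.hom 1).hom).baseChange ℂ)
      (if kt.2 = 0 then μ kt.1 else starRingEnd ℂ (μ kt.1))) = ⊤)
    (hKE : ∀ k, Module.End.eigenspace (((bettiCohomology.map φE.hom.hom.hom 1).hom).baseChange ℂ) (μ k) ≤
      Module.End.eigenspace (((bettiCohomology.map Φ.hom.hom.hom 1).hom).baseChange ℂ) (Complex.I * (Real.sqrt d : ℂ)))
    (hKE' : ∀ k, Module.End.eigenspace (((bettiCohomology.map φE.hom.hom.hom 1).hom).baseChange ℂ) (starRingEnd ℂ (μ k)) ≤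
      Module.End.eigenspace (((bettiCohomology.map Φ.hom.hom.hom 1).hom).baseChange ℂ) (-(Complex.I * (Real.sqrt d : ℂ))))
    (hC : centralizerAlgebra (Y.prod Z) = Subalgebra.centralizer ℂ {pullbackOne (Y.prod Z) φE})
    (hdiag : ⨆ m : ℂ, Module.End.eigenspace (pullbackOne (Y.prod Z) φE) m = ⊤)
    (hQ : IsRationalClass h) (hK : ∃ s : ℝ, 0 < s ∧ IsKaehlerClass (Y.prod Z).dim (Y.prod Z).X ((s : ℂ) • h))
    (J' : Module.End ℂ (complexBetti (Y.prod Z).X 1))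
    (hJ' : J' ∈ Subalgebra.centralizer ℂ (centralizerAlgebra (Y.prod Z) : Set (Module.End ℂ (complexBetti (Y.prod Z).X 1))))
    (hJQ : ∀ x y : complexBetti (Y.prod Z).X 1,
      polarizationPairingOne (Y.prod Z).X h ((Y.prod Z).dim - 1) (pullbackOne (Y.prod Z) φE x) y =
        polarizationPairingOne (Y.prod Z).X h ((Y.prod Z).dim - 1) x (J' y))
    (hφQ : ∀ x y, polarizationPairingOne (Y.prod Z).X h ((Y.prod Z).dim - 1) (pullbackOne (Y.prod Z) Φ x)
        (pullbackOne (Y.prod Z) Φ y) = (d : ℂ) • polarizationPairingOne (Y.prod Z).X h ((Y.prod Z).dim - 1) x y)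
    (hA'A : IsIsogenous A' (Y.prod Z)) : HodgeConjectureFor A'.dim A'.X := by
  haveI : HodgeTensorFacts.{0, 0} := hodgeTensorFacts_holds
  exact HodgeConjectureFor.of_isIsogenous hA'A
    (hodgeConjectureFor_weilType_generalE_of_markman₆_nonsplit (Y.prod Z) Φ d hMark₆ hRW6 hW φE hC hdiag hQ hK J' hJ' hJQ hφQ
      (hG_of_threefold_prod_cmThreefold hY3 φY hd hφY hE2 h1 hcm hZs hZ3 φZ hφZ Φ hΦ₁ hΦ₂ hW φE hEcard μ hinj hdist hWne htop
        hKE hKE' hQ hK hφQ))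

end Summit.HodgeConjecture.HodgeConjecture.TableX.WeilERows

end
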